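import Literature.IUT.LogVolume.DHProbabilisticSzpiroCorrected
import Mathlib.NumberTheory.RamificationInertia.Unramified
import Mathlib.RingTheory.RamificationInertia.Ramification
import HarnessLib

/-!
# Dupuy–Hilado (arXiv:2004.13108v2) §7.13 Thm 7.13.1 = Thm 1.0.4 (Baby Szpiro): the printed display
# (7.17) PROVED at every GENUINE section datum from (7.4) and (7.18), through the corrected chain —
# with the number-field inputs (7.19) and the replacement of (7.20) PROVED from Mathlib

PROOF-ONLY sequel of `DHProbabilisticSzpiroCorrected` (T. Dupuy, A. Hilado, arXiv:2004.13108v2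
[DupuyHilado2020], UNREFEREED; held render `book:anonnd-2004-13108v2`, locators `p.N l.M`). No new
definition, no new `Prop` fact: every declaration below is a theorem proved from Mathlib and the landed
files of this directory (`DHProbabilisticSzpiro`, `DHExplicitSzpiro`, `DHProbabilisticSzpiroCorrected`,
`FakeAdeleIndex`), whose vocabulary is cited BY NAME (`SectionRamification.ofLift`, `probUnram`,
`avgRamIdx`, `lnAvgDifferent`, `Ineq74`, `BabySzpiroInputs`, `BabySzpiroIneq`, `BabySzpiroClaim`,
`probabilisticSzpiro_corrected`, `sum_weight`, `probUnram_nonneg`, `ramIdx`, `residueChar`, `placesOver`, `weight`,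
`sum_localDegree`).

## What is PROVED (Thm 7.13.1 p.28 l.65–77 = Thm 1.0.4 p.3 l.44–56; proof p.29 l.1–33; footnote 10 p.29 l.44–60)

Print derives (7.17) "`(1/(6+ε_l))·ln|Δ^min_{E/F}|/[F:ℚ] ≤ ln([K:ℚ]^{5/4})·ln(|Disc(K/ℚ)|^{5/4}) + ln(π)`"
from (7.15) and "elementary bounds for the right hand side" (p.29 l.2): (7.18) `ln(Diff) ≤
ln(rad|Disc(K/ℚ)|·[K:ℚ])`, (7.19) `Σ_p ln e_p ≤ ln([K:ℚ])·ω(|Disc(K/ℚ)|)`, (7.20) `Σ_p (1 −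
P_{unr,p}^{(l+1)/4})(ln(b_p) + 4/(l+1)) ≤ ln|Disc(K/ℚ)|`, then "`ω(N) ≤ ln(N)/ln2(N)`" (l.22) and "Since
`D, d ≥ SL₂(𝔽_l) ≥ 6840`" (l.27). In the CORRECTED chain (`probabilisticSzpiro_corrected`: (7.15) with the
bracket `ln π + (4/(l+5))·Σ_p (1 − P_{unr,p}^{(l+1)/2})·ln p` the printed argument supports; §C rows
E-21/E-22 of the cell's errata register) the input (7.20) — whose `ln(b_p)`-credit is the (7.12) sign slip —
does not occur. What the corrected chain and (7.19) need are two CLASSICAL facts, PROVED here for the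
genuine datum `SectionRamification.ofLift K v̲` of a section `v ↦ v̲` of finite places of a number field `K`
(Mathlib: Dedekind's discriminant theorem `NumberField.not_dvd_discr_iff_forall_mem`; `Σ_{w|p} e_w f_w =
[K:ℚ]` = `sum_localDegree`): `residueChar_dvd_discr_of_ramIdx_ne_one` (`e(w/p) ≠ 1 ⇒ p ∣ Disc(K/ℚ)`) and
`ramIdx_le_finrank` (`e(w/p) ≤ [K:ℚ]`). From them:

* `sum_one_sub_probUnram_pow_mul_log_le` — `Σ_{p∈T} (1 − P_{unr,p}^k)·ln p ≤ ln rad|Disc(K/ℚ)|` (the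
  corrected chain's replacement of (7.20)); `sum_log_avgRamIdx_le` — **(7.19) PROVED**, `Σ_{p∈T} ln e_p ≤
  ω(|Disc(K/ℚ)|)·ln[K:ℚ]`, `ω` = number of PRIME divisors (`Nat.primeFactors.card`; footnote 10 p.29
  l.19–21 glosses `ω` as "number of divisors" and the typed `BabySzpiroInputs` follows that gloss; the
  bound print USES at l.22–24 is the prime-divisor count);
* `card_primeFactors_le_log` — `ω(N) ≤ ln N` for `N ≥ 8` (`rad N ≥ (ω(N)+1)! ≥ e^{ω(N)}`), the form in
  which print applies "`ω(N) ≤ ln(N)/ln2(N)`" at l.24 ("less than `ln(Dd) + ln(D)ln(d) + ln(D)`");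
* `babySzpiro_structural` — from (7.4) (`Ineq74`, the ONLY entrance of [IUTchIII] Cor. 3.12 and Claim
  5.0.1; a typed hypothesis) and (7.18) (typed hypothesis = first conjunct of `BabySzpiroInputs`, consumed
  BY NAME; its footnote-10 derivation is NOT vouched for here): `(1/(6+ε_l))·deĝ̲(𝔮) ≤ ln(rad D·d) +
  ω(D)·ln d + ln π + (4/(l+5))·ln rad D` (`d = [K:ℚ]`, `D = |Disc(K/ℚ)|`);
* `babySzpiro_corrected` — **the printed (7.17) = `BabySzpiroIneq X [K:ℚ] |Disc(K/ℚ)|`** for `d, D ≥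
  6840`: the printed 5/4-exponents SURVIVE the slips E-21/E-22 (those change Thm 1.0.3's `A_{l,V}`, not
  Thm 1.0.4's display); `babySzpiroClaim_ofLift` — the typed template `BabySzpiroClaim` DISCHARGED at every
  genuine section datum (of its `BabySzpiroInputs` only (7.18) is used), under `bad ⇒ ramified` (p.22
  l.24; the hypothesis of the corrected (7.5), `E2_radiusLn_le`).

HONEST FRAMING: everything here is downstream of `Ineq74` = the authors' probabilistic reading of the
DISPUTED [IUTchIII] Cor. 3.12 [claim: Mochizuki2012, status: disputed] plus Lemma 6.3.1 / Claim 5.0.1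
[claim: DupuyHilado2020, status: under-review], a typed hypothesis that is NEVER asserted; and of (7.18),
likewise a typed hypothesis. What is proved is `(7.4) ∧ (7.18) ⟹ (7.17)` at genuine data — a theorem ABOUT
the candidate templates. Nothing is claimed about the truth of Thm 1.0.4; typed ≠ proved ≠ endorsed; no
side is taken on any author; no abc claim.
-/

noncomputable section

namespace Literature.IUT.LogVolume

open NumberField IsDedekindDomain Finset

/-! ## Classical number-field inputs (Mathlib) -/
section Classical

variable (K : Type*) [Field K] [NumberField K]

/-- **Dedekind's discriminant theorem, the direction print uses at (7.19)/(7.20) and Lemma 8.4.1**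
("a prime ramifies in `K` only if it divides `Disc(K/ℚ)`"): for a finite place `w` of `K` with
`e(w/p) ≠ 1` (the tree's `ramIdx`), `p = char κ(w)` divides `Disc(K/ℚ)` (Mathlib's `NumberField.discr`).
PROVED from Mathlib (`NumberField.not_dvd_discr_iff_forall_mem`, `Ideal.ramificationIdx_eq_one`).
[folklore] [cite: DupuyHilado2020, (7.19)–(7.20) p.29 l.4–18; Lemma 8.4.1 proof p.33 l.1–10] -/
theorem residueChar_dvd_discr_of_ramIdx_ne_one (w : HeightOneSpectrum (𝓞 K)) (hw : ramIdx K w ≠ 1) :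
    (residueChar K w : ℤ) ∣ NumberField.discr K := by
  have hp : (residueChar K w).Prime := residueChar_prime K w
  have hpZ : Prime (residueChar K w : ℤ) := Nat.prime_iff_prime_int.mp hp
  by_contra h
  have hunr := (NumberField.not_dvd_discr_iff_forall_mem K (𝓞 K) hpZ).mp h w.asIdeal inferInstance
  have hmem : ((residueChar K w : ℤ) : 𝓞 K) ∈ w.asIdeal := by
    have h1 : (residueChar K w : ℤ) ∈ w.asIdeal.under ℤ := by
      rw [(liesOver_residueChar K w).over.symm]
      exact Ideal.mem_span_singleton_self _
    simpa [Ideal.mem_comap] using h1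
  haveI := hunr hmem
  have h1 : w.asIdeal.ramificationIdx ℤ = 1 := Ideal.ramificationIdx_eq_one w.asIdeal ℤ
  have hne : Ideal.span {(residueChar K w : ℤ)} ≠ ⊥ := by simp [hp.ne_zero]
  have h2 : ramIdx K w = w.asIdeal.ramificationIdx ℤ := by
    unfold ramIdx
    exact Ideal.ramificationIdx'_eq_ramificationIdx (p := Ideal.span {(residueChar K w : ℤ)})
      (q := w.asIdeal) hne
  exact hw (h2.trans h1)

/-- `e(w/p) ≤ e(w/p)·f(w/p) ≤ Σ_{w'|p} e_{w'} f_{w'} = [K:ℚ]` (print, Lemma 8.1.1 proof p.30 l.7–8: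
"`e(w/p) ≤ [K:ℚ]`"). PROVED (`sum_localDegree`). [folklore] [cite: DupuyHilado2020, Lemma 8.1.1 proof p.30 l.7–8] -/
theorem ramIdx_le_finrank (w : HeightOneSpectrum (𝓞 K)) : ramIdx K w ≤ Module.finrank ℚ K := by
  haveI : Fact (residueChar K w).Prime := ⟨residueChar_prime K w⟩
  have hmem := mem_placesOver_residueChar w
  calc ramIdx K w ≤ localDegree K w :=
        Nat.le_mul_of_pos_right _ (Nat.pos_of_ne_zero (resDeg_ne_zero K w))
    _ ≤ ∑ v ∈ placesOver K (residueChar K w), localDegree K v :=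
        Finset.single_le_sum (fun v _ => Nat.zero_le _) hmem
    _ = Module.finrank ℚ K := sum_localDegree K _

/-- A finite set of natural numbers `≥ 2` with `k` elements has product `≥ (k+1)!` (its `i`-th smallest
member is `≥ i+2`). Elementary private helper for `ω(N) ≤ ln N`. [folklore] -/
private theorem factorial_card_succ_le_prod (s : Finset ℕ) :
    (∀ b ∈ s, 2 ≤ b) → Nat.factorial (s.card + 1) ≤ ∏ b ∈ s, b := by
  refine Finset.induction_on_max s (fun _ => by simp) ?_
  intro a s ha ih hs
  have hs' : ∀ b ∈ s, 2 ≤ b := fun b hb => hs b (Finset.mem_insert_of_mem hb)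
  have hnot : a ∉ s := fun h => lt_irrefl a (ha a h)
  have hcard : s.card + 2 ≤ a := by
    have h1 := Finset.card_le_card (fun b hb => Finset.mem_Ico.mpr ⟨hs' b hb, ha b hb⟩ : s ⊆ Finset.Ico 2 a)
    have h2 : 2 ≤ a := hs a (Finset.mem_insert_self a s)
    rw [Nat.card_Ico] at h1; omega
  rw [Finset.prod_insert hnot, Finset.card_insert_of_notMem hnot, Nat.factorial_succ]
  exact Nat.mul_le_mul hcard (ih hs')

/-- `e^n ≤ 2.7182818286^n` (Mathlib's `Real.exp_one_lt_d9`); private helper. [folklore] -/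
private theorem exp_natCast_le_d9_pow (n : ℕ) : Real.exp n ≤ (2.7182818286 : ℝ) ^ n := by
  rw [show Real.exp (n : ℝ) = Real.exp 1 ^ n by rw [← Real.exp_nat_mul, mul_one]]
  have h0 : 0 ≤ Real.exp 1 := (Real.exp_pos 1).le
  have h := Real.exp_one_lt_d9
  gcongr

/-- `e^k ≤ (k+1)!` for `k ≥ 3` (`e³ < 20.1 ≤ 24`, then `e ≤ k+2`). Elementary private helper. [folklore] -/
private theorem exp_nat_le_factorial_succ (k : ℕ) (hk : 3 ≤ k) :
    Real.exp k ≤ (Nat.factorial (k + 1) : ℝ) := by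
  induction k, hk using Nat.le_induction with
  | base => exact (exp_natCast_le_d9_pow 3).trans (by norm_num [Nat.factorial])
  | succ k hk ih =>
    have h := Real.exp_one_lt_d9
    have hk' : (3 : ℝ) ≤ k := by exact_mod_cast hk
    have he : Real.exp 1 ≤ (k : ℝ) + 2 := by linarith
    have h1 : Real.exp ((k + 1 : ℕ) : ℝ) = Real.exp k * Real.exp 1 := by
      rw [← Real.exp_add]; push_cast; ring_nf
    rw [h1, show k + 1 + 1 = (k + 1) + 1 from rfl, Nat.factorial_succ (k + 1)]
    push_cast
    have h0 : (0 : ℝ) ≤ Nat.factorial (k + 1) := by positivity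
    calc Real.exp k * Real.exp 1 ≤ (Nat.factorial (k + 1) : ℝ) * ((k : ℝ) + 2) :=
          mul_le_mul ih he (Real.exp_pos 1).le h0
      _ = ((k : ℝ) + 1 + 1) * (Nat.factorial (k + 1) : ℝ) := by ring

/-- **`ω(N) ≤ ln N` for `N ≥ 8`** (`ω` = number of distinct prime divisors, `Nat.primeFactors.card`):
`N ≥ rad N ≥ (ω(N)+1)! ≥ e^{ω(N)}` when `ω(N) ≥ 3`, and `ln N ≥ ln 8 > 2` otherwise. This is the form in
which print USES "`ω(N) ≤ ln(N)/ln2(N)`" (p.29 l.22 → l.24). Elementary, PROVED. [folklore]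
[cite: DupuyHilado2020, Thm 7.13.1 proof p.29 l.22–24] -/
theorem card_primeFactors_le_log (N : ℕ) (hN : 8 ≤ N) : (N.primeFactors.card : ℝ) ≤ Real.log N := by
  have hN0 : N ≠ 0 := by omega
  have hNpos : (0 : ℝ) < N := by exact_mod_cast Nat.pos_of_ne_zero hN0
  rcases le_or_gt N.primeFactors.card 2 with hk | hk
  · have h2 : (N.primeFactors.card : ℝ) ≤ 2 := by exact_mod_cast hk
    have h8 : Real.exp (2 : ℕ) ≤ (8 : ℝ) := (exp_natCast_le_d9_pow 2).trans (by norm_num)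
    have hlog : (2 : ℝ) ≤ Real.log N := by
      rw [Real.le_log_iff_exp_le hNpos]
      exact (by exact_mod_cast h8 : Real.exp 2 ≤ (8 : ℝ)).trans (by exact_mod_cast hN)
    linarith
  · have hk3 : 3 ≤ N.primeFactors.card := Nat.succ_le_of_lt hk
    have hprod : Nat.factorial (N.primeFactors.card + 1) ≤ ∏ p ∈ N.primeFactors, p :=
      factorial_card_succ_le_prod N.primeFactors (fun p hp => (Nat.prime_of_mem_primeFactors hp).two_le)
    have hdvd : ∏ p ∈ N.primeFactors, p ≤ N := Nat.le_of_dvd (Nat.pos_of_ne_zero hN0)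
      (Nat.prod_primeFactors_dvd N)
    have hexp : Real.exp (N.primeFactors.card : ℕ) ≤ (N : ℝ) :=
      (exp_nat_le_factorial_succ _ hk3).trans (by exact_mod_cast hprod.trans hdvd)
    rw [Real.le_log_iff_exp_le hNpos]
    exact hexp

end Classical

namespace ExplicitSzpiro

variable {F₀ : Type*} [Field F₀] [NumberField F₀]

/-! ## The genuine section datum `ofLift K v̲`: `P_{unr,p}`, `e_p` against `Disc(K/ℚ)` and `[K:ℚ]` -/
section OfLift

variable (K : Type*) [Field K] [NumberField K] (lift : HeightOneSpectrum (𝓞 F₀) → HeightOneSpectrum (𝓞 K))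

variable (R : SectionRamification F₀) in
/-- `1 ≤ e_p` (every `e(v̲/p) ≥ 1` and `Σ_v Pr(v) = 1`). [cite: DupuyHilado2020, Def. 1.0.2 (1.3) p.3 l.9–10] -/
theorem one_le_avgRamIdx (p : ℕ) [Fact p.Prime] : 1 ≤ R.avgRamIdx p := by
  unfold SectionRamification.avgRamIdx
  rw [← sum_weight (F₀ := F₀) p]
  refine Finset.sum_le_sum fun v _ => ?_
  exact le_mul_of_one_le_left (weight_nonneg F₀ v) (by exact_mod_cast R.one_le_e v)

/-- For the genuine datum of a section `v ↦ v̲` over the same rational prime: if `p ∤ Disc(K/ℚ)` then every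
`e(v̲/p) = 1` (Dedekind). [cite: DupuyHilado2020, (7.19)–(7.20) p.29 l.4–18] -/
theorem ofLift_e_eq_one_of_not_dvd (hlift : ∀ v, residueChar K (lift v) = residueChar F₀ v)
    (p : ℕ) [Fact p.Prime] (hD : ¬ p ∣ (NumberField.discr K).natAbs) :
    ∀ v ∈ placesOver F₀ p, (SectionRamification.ofLift K lift).e v = 1 := by
  intro v hv
  by_contra hne
  have hdvd := residueChar_dvd_discr_of_ramIdx_ne_one K (lift v) hne
  rw [hlift v, (mem_placesOver_iff_residueChar v).mp hv] at hdvd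
  exact hD (Int.natCast_dvd.mp hdvd)

/-- … so `P_{unr,p} = 1`. [cite: DupuyHilado2020, (7.20) p.29 l.9–18] -/
theorem probUnram_ofLift_eq_one_of_not_dvd (hlift : ∀ v, residueChar K (lift v) = residueChar F₀ v)
    (p : ℕ) [Fact p.Prime] (hD : ¬ p ∣ (NumberField.discr K).natAbs) :
    (SectionRamification.ofLift K lift).probUnram p = 1 := by
  unfold SectionRamification.probUnram
  rw [Finset.filter_true_of_mem (ofLift_e_eq_one_of_not_dvd K lift hlift p hD), sum_weight]

/-- Per prime: `(1 − P_{unr,p}^k)·ln p ≤ ln p` if `p ∣ Disc(K/ℚ)`, and `= 0` otherwise (genuine datum).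
[cite: DupuyHilado2020, (7.20) p.29 l.9–18] -/
theorem one_sub_probUnram_pow_mul_log_le (hlift : ∀ v, residueChar K (lift v) = residueChar F₀ v)
    (p : ℕ) [Fact p.Prime] (k : ℕ) :
    (1 - (SectionRamification.ofLift K lift).probUnram p ^ k) * Real.log p ≤
      if p ∣ (NumberField.discr K).natAbs then Real.log p else 0 := by
  split_ifs with hD
  · have hP := probUnram_nonneg (SectionRamification.ofLift K lift) p
    have hPk : 0 ≤ (SectionRamification.ofLift K lift).probUnram p ^ k := pow_nonneg hP k
    exact mul_le_of_le_one_left (Real.log_natCast_nonneg p) (by linarith)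
  · rw [probUnram_ofLift_eq_one_of_not_dvd K lift hlift p hD, one_pow, sub_self, zero_mul]

/-- `e_p ≤ [K:ℚ]` for the genuine datum (each `e(v̲/p) ≤ [K:ℚ]`, `Σ_v Pr(v) = 1`; print (7.19) via
"`e(w/p) ≤ [K:ℚ]`" p.30 l.7–8). [cite: DupuyHilado2020, (7.19) p.29 l.4–6] -/
theorem avgRamIdx_ofLift_le (p : ℕ) [Fact p.Prime] :
    (SectionRamification.ofLift K lift).avgRamIdx p ≤ Module.finrank ℚ K := by
  unfold SectionRamification.avgRamIdx
  calc ∑ v ∈ placesOver F₀ p, ((SectionRamification.ofLift K lift).e v : ℝ) * weight F₀ v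
      ≤ ∑ v ∈ placesOver F₀ p, (Module.finrank ℚ K : ℝ) * weight F₀ v :=
        Finset.sum_le_sum fun v _ => mul_le_mul_of_nonneg_right
          (by exact_mod_cast ramIdx_le_finrank K (lift v)) (weight_nonneg F₀ v)
    _ = Module.finrank ℚ K := by rw [← Finset.mul_sum, sum_weight, mul_one]

/-- If `p ∤ Disc(K/ℚ)` then `e_p = 1` (genuine datum). [cite: DupuyHilado2020, (7.19) p.29 l.4–6] -/
theorem avgRamIdx_ofLift_eq_one_of_not_dvd (hlift : ∀ v, residueChar K (lift v) = residueChar F₀ v)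
    (p : ℕ) [Fact p.Prime] (hD : ¬ p ∣ (NumberField.discr K).natAbs) :
    (SectionRamification.ofLift K lift).avgRamIdx p = 1 := by
  have hall := ofLift_e_eq_one_of_not_dvd K lift hlift p hD
  unfold SectionRamification.avgRamIdx
  rw [Finset.sum_congr rfl fun v hv => by rw [hall v hv], ← Finset.mul_sum, sum_weight]
  simp

/-- Per prime: `ln e_p ≤ ln[K:ℚ]` if `p ∣ Disc(K/ℚ)`, and `= 0` otherwise (genuine datum).
[cite: DupuyHilado2020, (7.19) p.29 l.4–6] -/
theorem log_avgRamIdx_ofLift_le (hlift : ∀ v, residueChar K (lift v) = residueChar F₀ v)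
    (p : ℕ) [Fact p.Prime] :
    Real.log ((SectionRamification.ofLift K lift).avgRamIdx p) ≤
      if p ∣ (NumberField.discr K).natAbs then Real.log (Module.finrank ℚ K) else 0 := by
  split_ifs with hD
  · have h1 := one_le_avgRamIdx (SectionRamification.ofLift K lift) p
    exact Real.log_le_log (by linarith) (avgRamIdx_ofLift_le K lift p)
  · rw [avgRamIdx_ofLift_eq_one_of_not_dvd K lift hlift p hD, Real.log_one]

/-- Bookkeeping: a sum over a set `T` of primes of terms supported on the prime divisors of `D ≠ 0` and
dominated there by `c ≥ 0` is at most `Σ_{p | D} c(p)`; private helper. [folklore] -/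
private theorem sum_le_sum_primeFactors (T : Finset ℕ) (hT : ∀ p ∈ T, p.Prime) (D : ℕ) (hD : D ≠ 0)
    (f c : ℕ → ℝ) (hc : ∀ p, 0 ≤ c p) (h : ∀ p ∈ T, f p ≤ if p ∣ D then c p else 0) :
    ∑ p ∈ T, f p ≤ ∑ p ∈ D.primeFactors, c p := by
  calc ∑ p ∈ T, f p ≤ ∑ p ∈ T, (if p ∣ D then c p else 0) := Finset.sum_le_sum h
    _ = ∑ p ∈ T.filter (fun p => p ∣ D), c p := (Finset.sum_filter _ _).symm
    _ ≤ ∑ p ∈ D.primeFactors, c p :=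
        Finset.sum_le_sum_of_subset_of_nonneg (fun p hp => by
          rw [Finset.mem_filter] at hp
          exact Nat.mem_primeFactors.mpr ⟨hT p hp.1, hp.2, hD⟩) (fun p _ _ => hc p)

/-- **The corrected chain's replacement of (7.20), PROVED** at the genuine datum: for a set `T` of primes,
`Σ_{p∈T} (1 − P_{unr,p}^k)·ln p ≤ Σ_{p | Disc(K/ℚ)} ln p = ln rad|Disc(K/ℚ)|`.
[cite: DupuyHilado2020, (7.20) p.29 l.9–18] -/
theorem sum_one_sub_probUnram_pow_mul_log_le (hlift : ∀ v, residueChar K (lift v) = residueChar F₀ v)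
    (T : Finset ℕ) (hT : ∀ p ∈ T, p.Prime) (k : ℕ) :
    ∑ p ∈ T, (1 - (SectionRamification.ofLift K lift).probUnram p ^ k) * Real.log p ≤
      ∑ p ∈ (NumberField.discr K).natAbs.primeFactors, Real.log p := by
  refine sum_le_sum_primeFactors T hT _ (Int.natAbs_ne_zero.mpr (NumberField.discr_ne_zero K))
    _ (fun p => Real.log p) (fun p => Real.log_natCast_nonneg p) fun p hp => ?_
  haveI : Fact p.Prime := ⟨hT p hp⟩
  exact one_sub_probUnram_pow_mul_log_le K lift hlift p k

/-- **(7.19) PROVED** at the genuine datum: for a set `T` of primes,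
`Σ_{p∈T} ln e_p ≤ ω(|Disc(K/ℚ)|)·ln[K:ℚ]`, `ω` = number of prime divisors.
[cite: DupuyHilado2020, (7.19) p.29 l.4–6] -/
theorem sum_log_avgRamIdx_le (hlift : ∀ v, residueChar K (lift v) = residueChar F₀ v)
    (T : Finset ℕ) (hT : ∀ p ∈ T, p.Prime) :
    ∑ p ∈ T, Real.log ((SectionRamification.ofLift K lift).avgRamIdx p) ≤
      ((NumberField.discr K).natAbs.primeFactors.card : ℝ) * Real.log (Module.finrank ℚ K) := by
  have h := sum_le_sum_primeFactors T hT _ (Int.natAbs_ne_zero.mpr (NumberField.discr_ne_zero K))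
    (fun p => Real.log ((SectionRamification.ofLift K lift).avgRamIdx p))
    (fun _ => Real.log (Module.finrank ℚ K)) (fun _ => Real.log_natCast_nonneg _) fun p hp => by
      haveI : Fact p.Prime := ⟨hT p hp⟩
      exact log_avgRamIdx_ofLift_le K lift hlift p
  rwa [Finset.sum_const, nsmul_eq_mul] at h
/-! ## Thm 7.13.1 (Baby Szpiro) through the corrected chain -/

variable (X : PilotData F₀)

/-- **Baby Szpiro, structural form, PROVED at the genuine datum**: from (7.4) (`Ineq74`) and (7.18) (the
first conjunct of the typed `BabySzpiroInputs`, a hypothesis), for `T` a set of primes containing the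
residue characteristics of the bad places and `bad ⇒ ramified` (`e(v̲/p) ≠ 1` on `S`),
`(1/(6+ε_l))·deĝ̲(𝔮) ≤ ln(rad D·d) + ω(D)·ln d + (ln π + (4/(l+5))·ln rad D)`, `d = [K:ℚ]`,
`D = |Disc(K/ℚ)|`, `rad D = Π_{p|D} p` — print's "`ln(Dd) + ln(D)ln(d) + ln(D)`" (p.29 l.24) before the
coarsenings `rad D ≤ D`, `ω(D) ≤ ln D`, `4/(l+5) ≤ 1`. [cite: DupuyHilado2020, Thm 7.13.1 proof p.29 l.1–26] -/
theorem babySzpiro_structural (hlift : ∀ v, residueChar K (lift v) = residueChar F₀ v)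
    (T : Finset ℕ) (hT : ∀ p ∈ T, p.Prime) (hS : ∀ v ∈ X.S, residueChar F₀ v ∈ T)
    (hNOS : ∀ v ∈ X.S, (SectionRamification.ofLift K lift).e v ≠ 1)
    (h74 : Ineq74 X (SectionRamification.ofLift K lift) T)
    (h18 : (SectionRamification.ofLift K lift).lnAvgDifferent T ≤
      Real.log ((∏ p ∈ (NumberField.discr K).natAbs.primeFactors, (p : ℝ)) * Module.finrank ℚ K)) :
    (1 / (6 + epsProb X.l)) * FinDivisor.ndeg F₀ X.qDivisor ≤
      Real.log ((∏ p ∈ (NumberField.discr K).natAbs.primeFactors, (p : ℝ)) * Module.finrank ℚ K)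
        + ((NumberField.discr K).natAbs.primeFactors.card : ℝ) * Real.log (Module.finrank ℚ K)
        + (Real.log Real.pi + (4 / ((X.l : ℝ) + 5)) *
            Real.log (∏ p ∈ (NumberField.discr K).natAbs.primeFactors, (p : ℝ))) := by
  have key := probabilisticSzpiro_corrected X (SectionRamification.ofLift K lift) T hT hS hNOS h74
  have hA := sum_log_avgRamIdx_le K lift hlift T hT
  have hB := sum_one_sub_probUnram_pow_mul_log_le K lift hlift T hT (X.lstar + 1)
  have hrad : ∑ p ∈ (NumberField.discr K).natAbs.primeFactors, Real.log p =
      Real.log (∏ p ∈ (NumberField.discr K).natAbs.primeFactors, (p : ℝ)) := by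
    rw [Real.log_prod]
    exact fun p hp => by exact_mod_cast (Nat.prime_of_mem_primeFactors hp).ne_zero
  rw [hrad] at hB
  have hB' := mul_le_mul_of_nonneg_left hB (by positivity : (0 : ℝ) ≤ 4 / ((X.l : ℝ) + 5))
  linarith

/-- `exp 8 < 6840` (`e^8 ≈ 2980.96`), so `ln x ≥ 8` for `x ≥ 6840` — print's floor "`D, d ≥ SL₂(𝔽_l) ≥
6840`" (p.29 l.27) is more than `e^8` needed for `ln x + 2 ≤ (5/4) ln x`. [cite: DupuyHilado2020, Thm 7.13.1 proof p.29 l.27–33] -/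
theorem eight_le_log_of_le {x : ℝ} (hx : 6840 ≤ x) : 8 ≤ Real.log x := by
  have hxpos : 0 < x := by linarith
  rw [Real.le_log_iff_exp_le hxpos]
  have h8 : Real.exp (8 : ℕ) ≤ (6840 : ℝ) := (exp_natCast_le_d9_pow 8).trans (by norm_num)
  exact (by exact_mod_cast h8 : Real.exp 8 ≤ (6840 : ℝ)).trans hx

/-- **Theorem 7.13.1 = Theorem 1.0.4 (Baby Szpiro), the printed display (7.17) PROVED at the genuine
datum through the corrected chain**: for a number field `K`, a section `v ↦ v̲` of finite places over the
same rational primes, a pilot datum `X` over `F₀`, `T` a set of primes containing the residue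
characteristics of `S`, `bad ⇒ ramified`, and `[K:ℚ], |Disc(K/ℚ)| ≥ 6840` (print's floor p.29 l.27):
(7.4) ∧ (7.18) ⟹ `(1/(6+ε_l))·deĝ̲(𝔮) ≤ ln([K:ℚ]^{5/4})·ln(|Disc(K/ℚ)|^{5/4}) + ln(π)` = the typed
`BabySzpiroIneq X [K:ℚ] |Disc(K/ℚ)|`. Route: `babySzpiro_structural`, `rad D ≤ D`, `ω(D) ≤ ln D`
(`card_primeFactors_le_log`), `4/(l+5) ≤ 2/5`, and `(7/5)ln D + ln d + ln D·ln d ≤ (25/16)·ln d·ln D` for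
`ln d, ln D ≥ 8`. (7.20) and its `ln(b_p)` are not used. [cite: DupuyHilado2020, Thm 7.13.1 (7.17) p.28 l.65 – p.29 l.33] -/
theorem babySzpiro_corrected (hlift : ∀ v, residueChar K (lift v) = residueChar F₀ v)
    (T : Finset ℕ) (hT : ∀ p ∈ T, p.Prime) (hS : ∀ v ∈ X.S, residueChar F₀ v ∈ T)
    (hNOS : ∀ v ∈ X.S, (SectionRamification.ofLift K lift).e v ≠ 1)
    (hd : 6840 ≤ Module.finrank ℚ K) (hD : 6840 ≤ (NumberField.discr K).natAbs)
    (h74 : Ineq74 X (SectionRamification.ofLift K lift) T)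
    (h18 : (SectionRamification.ofLift K lift).lnAvgDifferent T ≤
      Real.log ((∏ p ∈ (NumberField.discr K).natAbs.primeFactors, (p : ℝ)) * Module.finrank ℚ K)) :
    BabySzpiroIneq X (Module.finrank ℚ K) (NumberField.discr K).natAbs := by
  have key := babySzpiro_structural K lift X hlift T hT hS hNOS h74 h18
  unfold BabySzpiroIneq
  set d : ℝ := (Module.finrank ℚ K : ℝ) with hd_def
  set D : ℝ := (((NumberField.discr K).natAbs : ℕ) : ℝ) with hD_def
  set r : ℝ := ∏ p ∈ (NumberField.discr K).natAbs.primeFactors, (p : ℝ) with hr_def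
  have hD0 : (NumberField.discr K).natAbs ≠ 0 := Int.natAbs_ne_zero.mpr (NumberField.discr_ne_zero K)
  have hdR : (6840 : ℝ) ≤ d := by rw [hd_def]; exact_mod_cast hd
  have hDR : (6840 : ℝ) ≤ D := by rw [hD_def]; exact_mod_cast hD
  have hdpos : 0 < d := by linarith
  have hr1 : 1 ≤ r := by
    rw [hr_def, ← Nat.cast_one, ← Nat.cast_prod, Nat.cast_le]
    exact Nat.one_le_iff_ne_zero.mpr (Finset.prod_ne_zero_iff.mpr fun p hp =>
      (Nat.prime_of_mem_primeFactors hp).ne_zero)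
  have hrD : r ≤ D := by
    rw [hr_def, hD_def, ← Nat.cast_prod, Nat.cast_le]
    exact Nat.le_of_dvd (Nat.pos_of_ne_zero hD0) (Nat.prod_primeFactors_dvd _)
  have hrpos : 0 < r := by linarith
  have hDpos : 0 < D := by linarith
  have ha : 8 ≤ Real.log d := eight_le_log_of_le hdR
  have hb : 8 ≤ Real.log D := eight_le_log_of_le hDR
  have hlogrD : Real.log r ≤ Real.log D := Real.log_le_log hrpos hrD
  have hω : (((NumberField.discr K).natAbs.primeFactors.card : ℕ) : ℝ) ≤ Real.log D :=
    card_primeFactors_le_log _ (le_trans (by norm_num) hD)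
  have hmul : Real.log (r * d) = Real.log r + Real.log d := Real.log_mul hrpos.ne' hdpos.ne'
  have hl : (4 : ℝ) / ((X.l : ℝ) + 5) ≤ 2 / 5 := by
    have h5 : (5 : ℝ) ≤ X.l := by exact_mod_cast X.five_le_l
    rw [div_le_div_iff₀ (by positivity) (by norm_num)]
    linarith
  have h54d : Real.log (d ^ ((5 : ℝ) / 4)) = (5 / 4) * Real.log d := Real.log_rpow hdpos _
  have h54D : Real.log (D ^ ((5 : ℝ) / 4)) = (5 / 4) * Real.log D := Real.log_rpow hDpos _
  rw [h54d, h54D]; rw [hmul] at key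
  have hωa : (((NumberField.discr K).natAbs.primeFactors.card : ℕ) : ℝ) * Real.log d ≤
      Real.log D * Real.log d := mul_le_mul_of_nonneg_right hω (by linarith)
  have h4r : (4 : ℝ) / ((X.l : ℝ) + 5) * Real.log r ≤ (2 / 5) * Real.log D :=
    mul_le_mul hl hlogrD (Real.log_nonneg hr1) (by norm_num)
  nlinarith [mul_le_mul ha hb (by norm_num) (by linarith : (0:ℝ) ≤ Real.log d),
    mul_nonneg (by linarith : (0:ℝ) ≤ Real.log d - 8) (by linarith : (0:ℝ) ≤ Real.log D - 8)]

/-- **The typed claim template `BabySzpiroClaim` (Thm 7.13.1 per datum) DISCHARGED at every genuine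
section datum** `ofLift K v̲` with `[K:ℚ]`, `|Disc(K/ℚ)|` of `K`, under `bad ⇒ ramified`: of its hypothesis
`BabySzpiroInputs` only the conjunct (7.18) is used ((7.19) is proved — in the prime-divisor form print
uses —, (7.20) is bypassed). A theorem ABOUT the template: `Ineq74` (the authors' reading of the disputed
[IUTchIII] Cor. 3.12 + Claim 5.0.1) stays a hypothesis inside it, never asserted.
[cite: DupuyHilado2020, Thm 7.13.1 p.28 l.65 – p.29 l.33] -/
theorem babySzpiroClaim_ofLift (hlift : ∀ v, residueChar K (lift v) = residueChar F₀ v)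
    (T : Finset ℕ) (hNOS : ∀ v ∈ X.S, (SectionRamification.ofLift K lift).e v ≠ 1) :
    BabySzpiroClaim X (SectionRamification.ofLift K lift) T (Module.finrank ℚ K)
      (NumberField.discr K).natAbs :=
  fun hT hS hd hD h74 hin => babySzpiro_corrected K lift X hlift T hT hS hNOS hd hD h74 hin.1

end OfLift

end ExplicitSzpiro

end Literature.IUT.LogVolume

end
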